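import Summits.BirchSwinnertonDyer.BirchSwinnertonDyer.Theorems.QuadraticBranchSignedControlPlusEtaNonsurjThetaFunctionalEquationHenselSeries
import HarnessLib

/-!
# Route `QuadraticBranchSignedControl` (rung K8, cell `bsd-potss`), residual crux `PlusEtaMainConjectureNonsurj`
# (stmt-BirchSwinnertonDyer-19606): THE FUNCTIONAL EQUATION ON THE QUADRATIC BRANCH, XXI — THE WEIERSTRASS POLYNOMIAL IS A CONTINUOUS,
# NORMALISATION-FREE READOUT: `L′ ≡ L (mod p^k, T^N)`, `N > k·d` ⇒ `P′ ≡ P (mod p^k)`; `L′ = v·L`, `v ∈ Λˣ` ⇒ `P′ = P`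
# (seat `bsd-potss-k8eta-c2` g29; kernel)

WHY. Parts XVI–XX speak about the Weierstrass polynomial `P` of a branch function `L = L_p^±(V, η, X)` (`L = p^μ·P·U`): it is
`w`-reciprocal (XVI), its shape is constrained (XVII–XVIII), one zero / one value pair pins it down when `λ = ord_T + 2` (XIX–XX), and census
P-29R READ `P mod 25` off the lineage's symbol data. THIS FILE supplies the two facts that make such readouts legitimate by name:
(§60–§61) **`p`-ADIC CONTINUITY OF WEIERSTRASS PREPARATION: if `L = P·U`, `L′ = P′·U′` (`P, P′` distinguished of the same degree `d`,
`U, U′ ∈ Λˣ`) and `L′ = L + p^k·D + T^N·G` with `N > k·d`, then `P′ ≡ P (mod p^k)` coefficientwise** — so `P mod p^k` is determined by the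
residues mod `p^k` of the first `k·d + 1` coefficients of `L` (the rigidity induction of Part XVI §35 with a precision cap: `p^s ∣ k_m` for
`m + s·d < N`); (§62) **NORMALISATION-FREENESS: `L′ = v·L` with `v ∈ Λˣ` ⇒ `P′ = P`** — all plus (resp. minus) branch functions of a row, for
every period ratio, have THE SAME Weierstrass polynomial (x1b: they are unit multiples of each other), a canonical polynomial invariant
`P⁺(V, η)` / `P⁻(V, η)` of the row carrying `λ`, the sign `P(−1) = w(V^{(p*)})`, the zeros, and the reciprocity (stated here for a common
period ratio; different period ratios change `L` by a constant of `ℚ^×`, absorbed by `μ` and the unit).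

WHAT. §60 `pow_dvd_coeff_of_truncation` (capped rigidity); §61 **`coeff_sub_dvd_of_truncation`** (`P′ ≡ P (mod p^k)`), `coeff_sub_dvd_of_congr`
(no truncation); §62 **`weierstrass_eq_of_mul_eq`** (`P′ = P`), `mu_lam_units_smul`, `weierstrass_eq_of_isQuadraticBranch{Plus,Minus}LFunction`
(two branch functions of the same newform and period ratio ⇒ same `P`); §63 (appended) **`coeff_sub_dvd_of_displayed`** (a DISPLAYED
factorization `L ≡ P₀·U₀ (mod p^k, T^N)`, `N > kd` ⇒ `P ≡ P₀ (mod p^k)`), `exists_weierstrass_congr_of_displayed` (tree currency `mu = 0`, `lam = d`).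

HONEST FRAMING (cell `bsd-potss`; FULL-BSD rank ≤ 1 programme, HUMAN RULING D-0036/D-0074): TOOL THEOREMS ONLY — no definition, no named
fact, no `sorry`, axioms standard; nothing about (A), (C1⁺_η), (E⁺_η), C-cc-1 or `BSD(W,p)` of any pair is claimed; crux and route OPEN;
nothing booked. `--supports stmt-BirchSwinnertonDyer-19606`.

References: [Washington1997] §7.1 (Thm. 7.3 and its proof: the division algorithm is `(p, T)`-adically convergent); [Kobayashi2003] Thm. 3.2;
[MazurTateTeitelbaum1986Invent] §I.13. Tree: Parts XVI, XIX; `Additive/QuadraticBranch{Plus,Minus}LFunctionUnique.lean` (x1b uniqueness).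
-/

set_option autoImplicit false
set_option linter.dupNamespace false
noncomputable section

open scoped Classical MatrixGroups ModularForm

open CongruenceSubgroup WeierstrassCurve Literature.NumberTheory.EllipticCurves
  Literature.NumberTheory.EllipticCurves.ModularForms
open Literature.NumberTheory.EllipticCurves.IwasawaAlgebra
open Summit.BirchSwinnertonDyer.Rank1Residual.Additive
open Summit.BirchSwinnertonDyer.Rank1Residual.X1.MuLambda (mu lam mu_mul lam_mul isUnit_iff_mu_eq_zero_and_lam_eq_zero)

namespace Summit.BirchSwinnertonDyer.BirchSwinnertonDyer.Theorems.EtaThetaFunctionalEquation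

variable {p : ℕ} [hp : Fact p.Prime]

/-! ## §60 Capped rigidity: `P′ = P·K + p^k·E + T^N·G` with `deg P′ ≤ d` ⇒ `p^s ∣ k_m` for `1 ≤ m`, `m + s·d < N`, `s ≤ k` -/

/-- **Capped rigidity.** `P` distinguished of degree `d`, `P′` a polynomial of degree `≤ d`, `P′ = P·K + p^k·E + T^N·G` in `Λ`: then
`p^s ∣ coeff_m K` whenever `1 ≤ m`, `s ≤ k` and `m + s·d < N` (`k_m = −Σ_{i<d} p_i k_{m+d−i} (mod p^k)` for `m + d < N`; induction on `s`).
[cite: Washington1997, §7.1 (Thm. 7.3)] -/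
theorem pow_dvd_coeff_of_truncation {P P' : Polynomial ℤ_[p]} (hP : P.IsDistinguishedAt (IsLocalRing.maximalIdeal ℤ_[p]))
    (hP' : P'.natDegree ≤ P.natDegree) {K E G : IwasawaAlgebra p} {k N : ℕ}
    (h : (P' : IwasawaAlgebra p) = (P : IwasawaAlgebra p) * K + PowerSeries.C ((p : ℤ_[p]) ^ k) * E + PowerSeries.X ^ N * G) :
    ∀ s, s ≤ k → ∀ m, 1 ≤ m → m + s * P.natDegree < N → (p : ℤ_[p]) ^ s ∣ PowerSeries.coeff m K := by
  have hlow : ∀ i, i < P.natDegree → (p : ℤ_[p]) ∣ P.coeff i := fun i hi ↦ by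
    rw [← Ideal.mem_span_singleton, ← PadicInt.maximalIdeal_eq_span_p]; exact hP.mem hi
  -- the coefficient identity above `d` and below `N`
  have hcoef : ∀ n, P.natDegree < n → n < N →
      PowerSeries.coeff n ((P : IwasawaAlgebra p) * K) = -((p : ℤ_[p]) ^ k * PowerSeries.coeff n E) := by
    intro n hn hnN
    have hc := congr_arg (PowerSeries.coeff n) h
    rw [Polynomial.coeff_coe, Polynomial.coeff_eq_zero_of_natDegree_lt (lt_of_le_of_lt hP' hn), map_add, map_add,
      PowerSeries.coeff_C_mul, PowerSeries.coeff_X_pow_mul', if_neg (not_le.mpr hnN), add_zero] at hc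
    linear_combination -hc
  intro s
  induction s with
  | zero => intro _ m _ _; rw [pow_zero]; exact one_dvd _
  | succ s ih =>
    intro hs m hm hmN
    have hs' : s ≤ k := by omega
    have h0 := hcoef (m + P.natDegree) (by omega) (by nlinarith)
    rw [PowerSeries.coeff_mul, ← Finset.add_sum_erase _ _
      (Finset.HasAntidiagonal.mem_antidiagonal.mpr (show (P.natDegree, m).1 + (P.natDegree, m).2 = m + P.natDegree by
        simp only; omega)), Polynomial.coeff_coe, hP.monic.coeff_natDegree, one_mul] at h0
    have hkm : PowerSeries.coeff m K = -((p : ℤ_[p]) ^ k * PowerSeries.coeff (m + P.natDegree) E) -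
        ∑ x ∈ (Finset.HasAntidiagonal.antidiagonal (m + P.natDegree)).erase (P.natDegree, m),
          PowerSeries.coeff x.1 (P : IwasawaAlgebra p) * PowerSeries.coeff x.2 K := by linear_combination h0
    rw [hkm]
    refine Dvd.dvd.sub (Dvd.dvd.neg_right (Dvd.dvd.mul_right (pow_dvd_pow _ (by omega)) _)) (Finset.dvd_sum fun x hx => ?_)
    obtain ⟨hne, hx'⟩ := Finset.mem_erase.mp hx
    have hsum : x.1 + x.2 = m + P.natDegree := Finset.HasAntidiagonal.mem_antidiagonal.mp hx'
    rw [Polynomial.coeff_coe]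
    rcases lt_trichotomy x.1 P.natDegree with hlt | heq | hgt
    · rw [pow_succ']
      exact mul_dvd_mul (hlow x.1 hlt) (ih hs' x.2 (by omega) (by nlinarith))
    · exfalso; apply hne
      exact Prod.ext heq (by simp only at hsum ⊢; omega)
    · rw [Polynomial.coeff_eq_zero_of_natDegree_lt hgt, zero_mul]; exact dvd_zero _

/-! ## §61 `L′ ≡ L (mod p^k, T^N)`, `N > k·d` ⇒ `P′ ≡ P (mod p^k)` -/

/-- **`p`-ADIC CONTINUITY OF THE WEIERSTRASS POLYNOMIAL.** `L = P·U`, `L′ = P′·U′` with `P, P′` distinguished of the SAME degree `d`,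
`U, U′ ∈ Λˣ`, and `L′ = L + p^k·D + T^N·G` with `k·d < N`: then `p^k ∣ coeff_i P′ − coeff_i P` for every `i` — `P mod p^k` depends only on
`L mod (p^k, T^{kd+1})`. [cite: Washington1997, §7.1 (Thm. 7.3)] -/
theorem coeff_sub_dvd_of_truncation {P P' : Polynomial ℤ_[p]} (hP : P.IsDistinguishedAt (IsLocalRing.maximalIdeal ℤ_[p]))
    (hP' : P'.IsDistinguishedAt (IsLocalRing.maximalIdeal ℤ_[p])) (hdeg : P'.natDegree = P.natDegree)
    {U U' L L' D G : IwasawaAlgebra p} (hU' : IsUnit U') (hL : L = (P : IwasawaAlgebra p) * U)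
    (hL' : L' = (P' : IwasawaAlgebra p) * U') {k N : ℕ} (hN : k * P.natDegree < N)
    (hLL : L' = L + PowerSeries.C ((p : ℤ_[p]) ^ k) * D + PowerSeries.X ^ N * G) (i : ℕ) :
    (p : ℤ_[p]) ^ k ∣ P'.coeff i - P.coeff i := by
  rcases Nat.eq_zero_or_pos k with hk | hk
  · rw [hk, pow_zero]; exact one_dvd _
  obtain ⟨k', rfl⟩ : ∃ k', k = k' + 1 := ⟨k - 1, (Nat.sub_add_cancel hk).symm⟩
  obtain ⟨V', hV'⟩ := hU'.exists_right_inv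
  set K : IwasawaAlgebra p := U * V' with hKdef
  -- `P′ = P·K + p^k·E + T^N·G′`
  have h : (P' : IwasawaAlgebra p) = (P : IwasawaAlgebra p) * K + PowerSeries.C ((p : ℤ_[p]) ^ (k' + 1)) * (D * V') +
      PowerSeries.X ^ N * (G * V') := by
    calc (P' : IwasawaAlgebra p) = (P' : IwasawaAlgebra p) * (U' * V') := by rw [hV', mul_one]
      _ = L' * V' := by rw [hL']; ring
      _ = _ := by rw [hLL, hL, hKdef]; ring
  have hrig := pow_dvd_coeff_of_truncation hP hdeg.le h
  have hlow : ∀ j, j < P.natDegree → (p : ℤ_[p]) ∣ P.coeff j := fun j hj ↦ by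
    rw [← Ideal.mem_span_singleton, ← PadicInt.maximalIdeal_eq_span_p]; exact hP.mem hj
  have hkd : k' * P.natDegree + P.natDegree < N := by rw [Nat.succ_mul] at hN; exact hN
  have hdN : P.natDegree < N := by omega
  -- `k_m ≡ 0 (mod p^{k'})` for `1 ≤ m ≤ d`
  have hKm : ∀ m, 1 ≤ m → m ≤ P.natDegree → (p : ℤ_[p]) ^ k' ∣ PowerSeries.coeff m K :=
    fun m hm hmd ↦ hrig k' (by omega) m hm (by omega)
  -- `coeff_i P′ ≡ p_i · k_0 (mod p^k)` for `i ≤ d`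
  have hcong : ∀ j, j ≤ P.natDegree → (p : ℤ_[p]) ^ (k' + 1) ∣ P'.coeff j - P.coeff j * PowerSeries.coeff 0 K := by
    intro j hj
    have hc := congr_arg (PowerSeries.coeff j) h
    rw [Polynomial.coeff_coe, map_add, map_add, PowerSeries.coeff_C_mul, PowerSeries.coeff_X_pow_mul', if_neg (by omega), add_zero,
      PowerSeries.coeff_mul, ← Finset.add_sum_erase _ _
        (Finset.HasAntidiagonal.mem_antidiagonal.mpr (show (j, 0).1 + (j, 0).2 = j by simp)), Polynomial.coeff_coe] at hc
    have e : P'.coeff j - P.coeff j * PowerSeries.coeff 0 K =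
        ∑ x ∈ (Finset.HasAntidiagonal.antidiagonal j).erase (j, 0), PowerSeries.coeff x.1 (P : IwasawaAlgebra p) *
          PowerSeries.coeff x.2 K + (p : ℤ_[p]) ^ (k' + 1) * PowerSeries.coeff j (D * V') := by linear_combination hc
    rw [e]
    refine Dvd.dvd.add (Finset.dvd_sum fun x hx => ?_) (dvd_mul_right _ _)
    obtain ⟨hne, hx'⟩ := Finset.mem_erase.mp hx
    have hsum : x.1 + x.2 = j := Finset.HasAntidiagonal.mem_antidiagonal.mp hx'
    have hx1 : x.1 < j := by
      rcases Nat.lt_or_ge x.1 j with h1 | h1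
      · exact h1
      · exfalso; apply hne; exact Prod.ext (by simp only; omega) (by simp only; omega)
    rw [Polynomial.coeff_coe, pow_succ']
    exact mul_dvd_mul (hlow x.1 (by omega)) (hKm x.2 (by omega) (by omega))
  -- `k_0 ≡ 1 (mod p^k)` from the top coefficients
  have hk0 : (p : ℤ_[p]) ^ (k' + 1) ∣ PowerSeries.coeff 0 K - 1 := by
    have hd := hcong P.natDegree le_rfl
    rw [← hdeg, hP'.monic.coeff_natDegree, hdeg, hP.monic.coeff_natDegree, one_mul] at hd
    have e : PowerSeries.coeff 0 K - 1 = -(1 - PowerSeries.coeff 0 K) := by ring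
    rw [e]; exact hd.neg_right
  by_cases hi : i ≤ P.natDegree
  · have e : P'.coeff i - P.coeff i = (P'.coeff i - P.coeff i * PowerSeries.coeff 0 K) + P.coeff i * (PowerSeries.coeff 0 K - 1) := by
      ring
    rw [e]
    exact (hcong i hi).add (hk0.mul_left _)
  · rw [Polynomial.coeff_eq_zero_of_natDegree_lt (show P'.natDegree < i by omega),
      Polynomial.coeff_eq_zero_of_natDegree_lt (show P.natDegree < i by omega), sub_zero]
    exact dvd_zero _

/-- **Without truncation**: `L′ = L + p^k·D` ⇒ `P′ ≡ P (mod p^k)`. [cite: Washington1997, §7.1 (Thm. 7.3)] -/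
theorem coeff_sub_dvd_of_congr {P P' : Polynomial ℤ_[p]} (hP : P.IsDistinguishedAt (IsLocalRing.maximalIdeal ℤ_[p]))
    (hP' : P'.IsDistinguishedAt (IsLocalRing.maximalIdeal ℤ_[p])) (hdeg : P'.natDegree = P.natDegree)
    {U U' L L' D : IwasawaAlgebra p} (hU' : IsUnit U') (hL : L = (P : IwasawaAlgebra p) * U)
    (hL' : L' = (P' : IwasawaAlgebra p) * U') {k : ℕ} (hLL : L' = L + PowerSeries.C ((p : ℤ_[p]) ^ k) * D) (i : ℕ) :
    (p : ℤ_[p]) ^ k ∣ P'.coeff i - P.coeff i :=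
  coeff_sub_dvd_of_truncation hP hP' hdeg hU' hL hL' (Nat.lt_succ_self _) (D := D) (G := 0)
    (by rw [hLL, mul_zero, add_zero]) i

/-! ## §62 Normalisation-freeness: `P′·U′ = P·U·v` (same degree) ⇒ `P′ = P` -/

/-- **THE WEIERSTRASS POLYNOMIAL IS NORMALISATION-FREE**: if `P′·U′ = P·U·v` in `Λ` with `P` distinguished, `P′` monic of the same degree,
`U′ ∈ Λˣ` (and ANY `U, v` — in applications units, e.g. `L′ = v·L` for two branch functions), then `P′ = P`: `P′ = P·K` has no coefficients
above `d`, so `K` is the constant `K(0)` (rigidity, Part XVI §35), and both are monic. [cite: Washington1997, §7.1 (Thm. 7.3)] -/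
theorem weierstrass_eq_of_mul_eq {P P' : Polynomial ℤ_[p]} (hP : P.IsDistinguishedAt (IsLocalRing.maximalIdeal ℤ_[p]))
    (hP'm : P'.Monic) (hdeg : P'.natDegree = P.natDegree) {U U' v : IwasawaAlgebra p} (hU' : IsUnit U')
    (h : (P' : IwasawaAlgebra p) * U' = (P : IwasawaAlgebra p) * U * v) : P' = P := by
  obtain ⟨V', hV'⟩ := hU'.exists_right_inv
  have h2 : (P' : IwasawaAlgebra p) = (P : IwasawaAlgebra p) * (U * v * V') := by
    calc (P' : IwasawaAlgebra p) = (P' : IwasawaAlgebra p) * (U' * V') := by rw [hV', mul_one]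
      _ = (P : IwasawaAlgebra p) * U * v * V' := by rw [← mul_assoc, h]
      _ = _ := by ring
  have hKc := eq_C_of_distinguished_mul hP (K := U * v * V') fun n hn ↦ by
    rw [← h2, Polynomial.coeff_coe, Polynomial.coeff_eq_zero_of_natDegree_lt (by omega)]
  have hc : PowerSeries.constantCoeff (U * v * V') = 1 := by
    have htop := congr_arg (PowerSeries.coeff P.natDegree) h2
    rw [hKc, mul_comm, PowerSeries.coeff_C_mul, Polynomial.coeff_coe, Polynomial.coeff_coe, ← hdeg, hP'm.coeff_natDegree, hdeg,
      hP.monic.coeff_natDegree, mul_one] at htop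
    exact htop.symm
  apply Polynomial.coe_injective
  rw [h2, hKc, hc, map_one, mul_one]

/-- `μ` and `λ` of a UNIT CONSTANT multiple: `mu (C v · L) = mu L`, `lam (C v · L) = lam L` for `v ∈ ℤ_pˣ`, `L ≠ 0`. [folklore] -/
theorem mu_lam_units_smul {L : IwasawaAlgebra p} (hL0 : L ≠ 0) (v : ℤ_[p]ˣ) :
    mu (PowerSeries.C (v : ℤ_[p]) * L) = mu L ∧ lam (PowerSeries.C (v : ℤ_[p]) * L) = lam L := by
  have hu : IsUnit (PowerSeries.C (v : ℤ_[p]) : IwasawaAlgebra p) := (Units.isUnit v).map PowerSeries.C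
  obtain ⟨hne, hmu, hlam⟩ := (isUnit_iff_mu_eq_zero_and_lam_eq_zero _).mp hu
  exact ⟨by rw [mu_mul hne hL0, hmu, zero_add], by rw [lam_mul hne hL0, hlam, zero_add]⟩

section Branch

variable {N : ℕ} [NeZero N] {f : CuspForm (Gamma0 N) 2}

omit [NeZero N] in
/-- **ALL PLUS BRANCH FUNCTIONS (same newform, same period ratio) HAVE THE SAME WEIERSTRASS POLYNOMIAL**: for `p` odd, two plus branch
functions `L, L′` (`IsQuadraticBranchPlusLFunction f p ϖ ·`; by x1b `L′ = v·L`, `v ∈ ℤ_pˣ`) and their Weierstrass data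
`L = p^{μ(L)}·P·U`, `L′ = p^{μ(L′)}·P′·U′` with `deg P = λ(L)`, `deg P′ = λ(L′)` (Part XVI `exists_weierstrass_of_ne_zero`): `P′ = P` — the
Weierstrass polynomial `P⁺(f, η)` is a canonical invariant. [cite: Kobayashi2003, Thm. 3.2, (3.4)] [cite: Washington1997, §7.1 (Thm. 7.3)] -/
theorem weierstrass_eq_of_isQuadraticBranchPlusLFunction (hp2 : p ≠ 2) {ϖ : ℚ} {L L' : IwasawaAlgebra p} (hL0 : L ≠ 0)
    (hL : IsQuadraticBranchPlusLFunction f p ϖ L) (hL' : IsQuadraticBranchPlusLFunction f p ϖ L')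
    {P P' : Polynomial ℤ_[p]} (hP : P.IsDistinguishedAt (IsLocalRing.maximalIdeal ℤ_[p]))
    (hP' : P'.IsDistinguishedAt (IsLocalRing.maximalIdeal ℤ_[p])) {U U' : IwasawaAlgebra p} (hU' : IsUnit U')
    (hLP : L = PowerSeries.C ((p : ℤ_[p]) ^ mu L) * (P : IwasawaAlgebra p) * U)
    (hLP' : L' = PowerSeries.C ((p : ℤ_[p]) ^ mu L') * (P' : IwasawaAlgebra p) * U')
    (hd : P.natDegree = lam L) (hd' : P'.natDegree = lam L') : P' = P := by
  obtain ⟨v, hv⟩ := IsQuadraticBranchPlusLFunction.exists_units_smul_eq hp2 hL hL'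
  rw [PowerSeries.smul_eq_C_mul] at hv
  obtain ⟨hmu, hlam⟩ := mu_lam_units_smul hL0 v
  rw [← hv] at hmu hlam
  have hCp : (PowerSeries.C ((p : ℤ_[p]) ^ mu L) : IwasawaAlgebra p) ≠ 0 := fun h ↦
    pow_ne_zero _ (Nat.cast_ne_zero.mpr hp.out.ne_zero : (p : ℤ_[p]) ≠ 0) (by simpa using congr_arg PowerSeries.constantCoeff h)
  have h : (P' : IwasawaAlgebra p) * U' = (P : IwasawaAlgebra p) * U * PowerSeries.C (v : ℤ_[p]) := by
    refine mul_left_cancel₀ hCp ?_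
    have h1 := hv
    rw [hLP, hLP', hmu] at h1
    linear_combination h1
  exact weierstrass_eq_of_mul_eq hP hP'.monic (by rw [hd, hd', hlam]) hU' h

omit [NeZero N] in
/-- **MINUS TWIN**: two minus branch functions (same `f`, same `ϖ`) have the same Weierstrass polynomial `P⁻(f, η)`.
[cite: Kobayashi2003, Thm. 3.2, (3.5)] [cite: Washington1997, §7.1 (Thm. 7.3)] -/
theorem weierstrass_eq_of_isQuadraticBranchMinusLFunction (hp2 : p ≠ 2) {ϖ : ℚ} {L L' : IwasawaAlgebra p} (hL0 : L ≠ 0)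
    (hL : IsQuadraticBranchMinusLFunction f p ϖ L) (hL' : IsQuadraticBranchMinusLFunction f p ϖ L')
    {P P' : Polynomial ℤ_[p]} (hP : P.IsDistinguishedAt (IsLocalRing.maximalIdeal ℤ_[p]))
    (hP' : P'.IsDistinguishedAt (IsLocalRing.maximalIdeal ℤ_[p])) {U U' : IwasawaAlgebra p} (hU' : IsUnit U')
    (hLP : L = PowerSeries.C ((p : ℤ_[p]) ^ mu L) * (P : IwasawaAlgebra p) * U)
    (hLP' : L' = PowerSeries.C ((p : ℤ_[p]) ^ mu L') * (P' : IwasawaAlgebra p) * U')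
    (hd : P.natDegree = lam L) (hd' : P'.natDegree = lam L') : P' = P := by
  obtain ⟨v, hv⟩ := IsQuadraticBranchMinusLFunction.exists_units_smul_eq hp2 hL hL'
  rw [PowerSeries.smul_eq_C_mul] at hv
  obtain ⟨hmu, hlam⟩ := mu_lam_units_smul hL0 v
  rw [← hv] at hmu hlam
  have hCp : (PowerSeries.C ((p : ℤ_[p]) ^ mu L) : IwasawaAlgebra p) ≠ 0 := fun h ↦
    pow_ne_zero _ (Nat.cast_ne_zero.mpr hp.out.ne_zero : (p : ℤ_[p]) ≠ 0) (by simpa using congr_arg PowerSeries.constantCoeff h)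
  have h : (P' : IwasawaAlgebra p) * U' = (P : IwasawaAlgebra p) * U * PowerSeries.C (v : ℤ_[p]) := by
    refine mul_left_cancel₀ hCp ?_
    have h1 := hv
    rw [hLP, hLP', hmu] at h1
    linear_combination h1
  exact weierstrass_eq_of_mul_eq hP hP'.monic (by rw [hd, hd', hlam]) hU' h

end Branch

/-! ## §63 The readout form: a DISPLAYED factorization `L ≡ P₀·U₀ (mod p^k, T^N)` certifies `P ≡ P₀ (mod p^k)` (appended, g29) -/

/-- **CERTIFIED READOUT OF `P mod p^k`.** Let `L = P·U` be the (unknown) Weierstrass datum (`μ = 0`) and let `P₀ ∈ ℤ_p[T]` distinguished of the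
same degree `d`, `U₀, D, G ∈ Λ` be DISPLAYED (e.g. polynomials) with `L = P₀·U₀ + p^k·D + T^N·G`, `N > k·d`. Then `P ≡ P₀ (mod p^k)`
coefficientwise (no hypothesis on `U₀`: `U₀(0) ∈ ℤ_pˣ` is forced). (The census P-29R computed such `P₀ mod 25` from 20 coefficients of
`ℓ_2 ≡ ±M⁺`.) [cite: Washington1997, §7.1 (Thm. 7.3)] -/
theorem coeff_sub_dvd_of_displayed {P P₀ : Polynomial ℤ_[p]} (hP : P.IsDistinguishedAt (IsLocalRing.maximalIdeal ℤ_[p]))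
    (hP₀ : P₀.IsDistinguishedAt (IsLocalRing.maximalIdeal ℤ_[p])) (hdeg : P₀.natDegree = P.natDegree)
    {U U₀ L D G : IwasawaAlgebra p} (hU : IsUnit U) (hL : L = (P : IwasawaAlgebra p) * U) {k N : ℕ} (hN : k * P.natDegree < N)
    (hdisp : L = (P₀ : IwasawaAlgebra p) * U₀ + PowerSeries.C ((p : ℤ_[p]) ^ k) * D + PowerSeries.X ^ N * G) (i : ℕ) :
    (p : ℤ_[p]) ^ k ∣ P.coeff i - P₀.coeff i := by
  have hN' : k * P₀.natDegree < N := by rw [hdeg]; exact hN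
  exact coeff_sub_dvd_of_truncation hP₀ hP hdeg.symm hU (L := (P₀ : IwasawaAlgebra p) * U₀) rfl hL hN' hdisp i

/-- **… at the tree's `λ`**: with `mu L = 0`, `lam L = d`, the tree's Weierstrass datum of `L` (Part XVI `exists_weierstrass_of_ne_zero`) and a
displayed factorization as above: the polynomial `P` of that datum satisfies `P ≡ P₀ (mod p^k)`. [cite: Washington1997, §7.1 (Thm. 7.3)] -/
theorem exists_weierstrass_congr_of_displayed {L : IwasawaAlgebra p} (hL0 : L ≠ 0) (hmu : mu L = 0) {P₀ : Polynomial ℤ_[p]}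
    (hP₀ : P₀.IsDistinguishedAt (IsLocalRing.maximalIdeal ℤ_[p])) (hdeg : P₀.natDegree = lam L)
    {U₀ D G : IwasawaAlgebra p} {k N : ℕ} (hN : k * lam L < N)
    (hdisp : L = (P₀ : IwasawaAlgebra p) * U₀ + PowerSeries.C ((p : ℤ_[p]) ^ k) * D + PowerSeries.X ^ N * G) :
    ∃ (P : Polynomial ℤ_[p]) (U : IwasawaAlgebra p), P.IsDistinguishedAt (IsLocalRing.maximalIdeal ℤ_[p]) ∧ IsUnit U ∧
      P.natDegree = lam L ∧ L = (P : IwasawaAlgebra p) * U ∧ ∀ i, (p : ℤ_[p]) ^ k ∣ P.coeff i - P₀.coeff i := by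
  obtain ⟨P, U, hP, hU, hd, hLP⟩ := exists_weierstrass_of_ne_zero hL0
  rw [hmu, pow_zero, map_one, one_mul] at hLP
  exact ⟨P, U, hP, hU, hd, hLP, coeff_sub_dvd_of_displayed hP hP₀ (hdeg.trans hd.symm) hU hLP (hd.symm ▸ hN) hdisp⟩

end Summit.BirchSwinnertonDyer.BirchSwinnertonDyer.Theorems.EtaThetaFunctionalEquation

end
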